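import Summits.BirchSwinnertonDyer.BirchSwinnertonDyer.Theses.GenusKolyvaginAtTwo
import Summits.BirchSwinnertonDyer.BirchSwinnertonDyer.Theorems.ByReductionTypeAtTwoRankOneAtTwoOffBigImageOddLocalDefs
import HarnessLib

/-!
# Route `ByReductionTypeAtTwo`, crux `RankOneAtTwoOffBigImageOddLocal` (stmt-BirchSwinnertonDyer-23716), line
# `refined_kolyvagin_tamagawa_shift_at_two` — the K3 stub S5″ on {full `2`-adic image, `Δ < 0`} IS the sibling route's
# open item `KolyvaginExactAtTwoShifted` (stmt-BirchSwinnertonDyer-27469), at EVERY shift `σ`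

Lead prover `prover-cruxlead-stmt-BirchSwinnertonDyer-23716-g4` (2026-08-28).  The line's K3 statement
`ShiftedKolyvaginStructureModTwoWithOn Φ Ω` (McCallum's structure theorem at `p = 2` on a cell `Ω` of the mod-`2`-surjective locus,
with the shift `σ(W, Dt) = v₂ ∏ c_ℓ(W) + v₂ c(Dt)`: K1-shape ∧ K2(Φ)-shape ⟹ `#Ш(E/K)[2^∞] = 2^{2(M₀ − σ)}`) and route
`GenusKolyvaginAtTwo`'s item `KolyvaginExactAtTwoShifted` (stmt-27469: the same structure theorem on {`Δ < 0`, `ρ_{W,2^∞}` onto} with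
the shift a FREE parameter `t` — «under universal `2^s`-divisibility of all derived points on `Λ_s` for `s ≤ t` and a primitivity
certificate at depth `t + 1`, `#Ш(E/K)[2^∞] = 2^{2(M₀ − t)}`») COINCIDE on {full `2`-adic image, `Δ < 0`} at `t := σ(W, Dt)`, for every
`σ` (not only `σ = 0`, where the companion file `…OffBigImageOddLocalSiblingBridge.lean`, p660076, meets the parent crux 22137):

* `shiftedStructure_of_kolyvaginExactAtTwoShifted` — 27469 ⟹ the conclusion of S5″ at every full-image `Δ < 0` curve and every datum
  (per-datum form; the only translation is Zhang's level index `M(n) = min_{ℓ ∣ n} M(ℓ)`: `(s : ℕ∞) ≤ levelIndex W 2 n ↔ ∀ ℓ ∣ n,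
  s ≤ kolyvaginIndex W 2 ℓ`, `Zhang2014.natCast_le_levelIndex_iff`, and the `(2 : ℤ) ^ n` / `((2 ^ n : ℕ) : ℤ)` spelling of the image
  hypothesis);
* `structureWithOn_fullImageNegDisc_of_kolyvaginExactAtTwoShifted` — hence `ShiftedKolyvaginStructureModTwoWithOn Φ Ω` for EVERY
  witness filter `Φ` and EVERY cell `Ω` inside {`ρ_{W,2^n}` onto ∀ `n`} ∩ {`Δ < 0`};
* `kolyvaginExactAtTwoShifted_at_of_structureWithOn` — conversely the cell statement (filter `⊤`, cell ⊇ full image ∩ `Δ < 0`) gives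
  27469's conclusion at every datum whose parameter `t` IS `σ(W, Dt)` (27469 exceeds the line's K3 exactly by the data with `t ≠ σ`,
  which BSD + Gross–Zagier make vacuous — recorded, not used).

Consequence for the line (pen RC-308 «re-line inside the skeleton; the K-side conjectures at 2 are GK2's items, 23716 consumes them by
name»): on the full-image cell the line's K3 is BY NAME — 22137 (`σ = 0`, either sign of `Δ`) and 27469 (every `σ`, `Δ < 0`) — except on
{`Δ > 0`, `σ ≥ 1`} (the engine's regime) and on the γ₂ cell.  Pure binder bookkeeping; nothing here proves S5″, 27469, `BSDp W 2`, BSD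
or the summit.  BSD is not proved.

Refs: [McCallumLMS1991] §5 (Thm. 5.4: `N_i = M_{i−1} − M_i`, so `#Ш = p^{2(M₀ − M_∞)}` for any `M_∞`); [WZhang2014] Notations (xii);
[Jetchev2008] (1.3); Burungale–Castella–Grossi–Skinner, arXiv:2312.09301, Thm. 2 (`M_∞ = Σ ord_p c_ℓ`, `p > 3`).
-/

set_option linter.dupNamespace false -- tree convention: `Summit.BirchSwinnertonDyer.BirchSwinnertonDyer.Theorems` (summit = sub-problem)
set_option autoImplicit false

noncomputable section

open scoped Classical

namespace Summit.BirchSwinnertonDyer.BirchSwinnertonDyer.Theorems.OffBigImageOddLocalAtTwo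

open WeierstrassCurve NumberField Literature.NumberTheory.EllipticCurves
  Literature.NumberTheory.EllipticCurves.ModularForms
  Summit.BirchSwinnertonDyer.BirchSwinnertonDyer.Theses.GenusKolyvaginAtTwo

/-- **27469 ⟹ S5″ on {full `2`-adic image, `Δ < 0`}, every shift.**  For `W` globally minimal non-CM with `Δ < 0` and `ρ_{W,2^n}` onto
for every `n`, a Kolyvagin-admissible `K` (odd `d_K ≠ −3`, Heegner hypothesis, Kolyvagin's two exclusions), any datum `Dt`, `β`, `ι`,
`y_K = P(1)` of infinite order with `2^{M₀} ∥ P(1)`; IF every derived point `P(n)` (square-free product of Kolyvagin primes at `2`) is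
`2^m`-divisible for every `m ≤ min(σ(W, Dt), M(n))` AND some `P(n)` at level `M(n) ≥ σ + 1` is not `2^{σ+1}`-divisible, THEN
`#Ш(E/K)[2^∞] = 2^{2(M₀ − σ)}` — by the sibling item `KolyvaginExactAtTwoShifted` at `t := σ(W, Dt)`.
[cite: McCallumLMS1991, §5 Thm. 5.4] [cite: WZhang2014, Notations (xii)] -/
theorem shiftedStructure_of_kolyvaginExactAtTwoShifted (h : KolyvaginExactAtTwoShifted)
    (W : WeierstrassCurve ℚ) [W.IsElliptic] [W.IsGloballyMinimal] [NeZero (W.conductorNorm ℤ)]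
    (hCM : ¬ W.HasCM) (hΔ : W.Δ < 0) (hfull : ∀ n : ℕ, W.HasSurjectiveModNGaloisRep ((2 ^ n : ℕ) : ℤ))
    (K : Type) [Field K] [NumberField K] (hK : IsImaginaryQuadratic K) (hodd : Odd (NumberField.discr K))
    (h3 : NumberField.discr K ≠ -3) (hH : SatisfiesHeegnerHypothesis (W.conductorNorm ℤ) K)
    (hsq1 : ¬ IsSquare ((NumberField.discr K : ℚ) * -|W.Δ|)) (hsq2 : ¬ IsSquare ((NumberField.discr K : ℚ) * (-(2 * |W.Δ|))))
    (Dt : ModularParametrizationData W (W.conductorNorm ℤ)) (β : ℤ) (ι : K →+* ℂ) (d₁ : KolyvaginHeegnerData Dt β ι 1)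
    (hy : ¬ IsOfFinAddOrder d₁.derivedPoint) (M₀ : ℕ)
    (hdiv : ∃ Q : (W.baseChange (ringClassField K ι 1)).toAffine.Point, ((2 ^ M₀ : ℕ) : ℤ) • Q = d₁.derivedPoint)
    (hndiv : ¬ ∃ Q : (W.baseChange (ringClassField K ι 1)).toAffine.Point, ((2 ^ (M₀ + 1) : ℕ) : ℤ) • Q = d₁.derivedPoint)
    (hacc : ∀ (n : ℕ) (d : KolyvaginHeegnerData Dt β ι n) (m : ℕ), Squarefree n →
      (∀ ℓ ∈ n.primeFactors, Zhang2014.IsKolyvaginPrime (W.conductorNorm ℤ) W K 2 ℓ) →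
      (m : ℕ∞) ≤ Zhang2014.levelIndex W 2 n → m ≤ sigmaShift W Dt →
      ∃ Q : (W.baseChange (ringClassField K ι n)).toAffine.Point, ((2 ^ m : ℕ) : ℤ) • Q = d.derivedPoint)
    (n : ℕ) (d : KolyvaginHeegnerData Dt β ι n) (hn : Squarefree n)
    (hKoly : ∀ ℓ ∈ n.primeFactors, Zhang2014.IsKolyvaginPrime (W.conductorNorm ℤ) W K 2 ℓ)
    (hlev : ((sigmaShift W Dt + 1 : ℕ) : ℕ∞) ≤ Zhang2014.levelIndex W 2 n)
    (hPn : ¬ ∃ Q : (W.baseChange (ringClassField K ι n)).toAffine.Point,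
      ((2 ^ (sigmaShift W Dt + 1) : ℕ) : ℤ) • Q = d.derivedPoint) :
    Nat.card (AddCommGroup.primaryComponent (W.baseChange K).sha 2) = 2 ^ (2 * (M₀ - sigmaShift W Dt)) := by
  have hfull' : ∀ m : ℕ, 0 < m → W.HasSurjectiveModNGaloisRep ((2 : ℤ) ^ m) := fun m _ => by
    have := hfull m
    push_cast at this
    exact this
  -- 27469's K1-shape hypothesis at `t := σ`, from the line's `levelIndex` form
  have hK1 : ∀ (s : ℕ), s ≤ sigmaShift W Dt → ∀ (n' : ℕ) (d' : KolyvaginHeegnerData Dt β ι n'), Squarefree n' →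
      (∀ ℓ ∈ n'.primeFactors, Zhang2014.IsKolyvaginPrime (W.conductorNorm ℤ) W K 2 ℓ ∧ s ≤ Zhang2014.kolyvaginIndex W 2 ℓ) →
      ∃ Q : (W.baseChange (ringClassField K ι n')).toAffine.Point, ((2 ^ s : ℕ) : ℤ) • Q = d'.derivedPoint :=
    fun s hs n' d' hn' hK' =>
      hacc n' d' s hn' (fun ℓ hℓ => (hK' ℓ hℓ).1)
        (Zhang2014.natCast_le_levelIndex_iff.mpr fun ℓ hℓ => (hK' ℓ hℓ).2) hs
  -- 27469's witness hypothesis: per-prime level `σ + 1 ≤ M(ℓ)`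
  have hKoly' : ∀ ℓ ∈ n.primeFactors, Zhang2014.IsKolyvaginPrime (W.conductorNorm ℤ) W K 2 ℓ ∧
      sigmaShift W Dt + 1 ≤ Zhang2014.kolyvaginIndex W 2 ℓ :=
    fun ℓ hℓ => ⟨hKoly ℓ hℓ, Zhang2014.natCast_le_levelIndex_iff.mp hlev ℓ hℓ⟩
  exact h W hCM hΔ K hK hodd h3 hH hsq1 hsq2 hfull' Dt β ι d₁ hy M₀ hdiv hndiv (sigmaShift W Dt) hK1 n d hn hKoly' hPn

/-- **27469 ⟹ `ShiftedKolyvaginStructureModTwoWithOn Φ Ω` for every filter `Φ` and every cell `Ω ⊆` {`ρ_{W,2^n}` onto ∀ `n`} ∩ {`Δ < 0`}.**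
The cell statement's K2-witness carries the filter `Φ` as an extra (unused) conjunct; the mod-`2` surjectivity binder is not used either (the
cell supplies the full image). [cite: McCallumLMS1991, §5 Thm. 5.4] -/
theorem structureWithOn_fullImageNegDisc_of_kolyvaginExactAtTwoShifted (h : KolyvaginExactAtTwoShifted)
    (Φ : WeierstrassCurve ℚ → ℕ → Prop) (Ω : WeierstrassCurve ℚ → Prop)
    (hΩfull : ∀ (W : WeierstrassCurve ℚ) [W.IsElliptic], Ω W → ∀ n : ℕ, W.HasSurjectiveModNGaloisRep ((2 ^ n : ℕ) : ℤ))
    (hΩneg : ∀ (W : WeierstrassCurve ℚ) [W.IsElliptic], Ω W → W.Δ < 0) :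
    ShiftedKolyvaginStructureModTwoWithOn Φ Ω := by
  intro W _ _ _ hCM _hρ hW K _ _ hK hodd h3 hH hsq1 hsq2 Dt β ι d₁ hy M₀ hdiv hndiv hacc n d hn hKoly hlev hPn
  exact shiftedStructure_of_kolyvaginExactAtTwoShifted h W hCM (hΩneg W hW) (hΩfull W hW) K hK hodd h3 hH hsq1 hsq2 Dt β ι
    d₁ hy M₀ hdiv hndiv hacc n d hn (fun ℓ hℓ => (hKoly ℓ hℓ).1) hlev hPn

/-- **Conversely, the cell statement gives 27469's conclusion at `t = σ(W, Dt)`.**  For a cell `Ω` containing {full image} ∩ {`Δ < 0`} and the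
numerical filter `⊤`: at every datum of a full-image `Δ < 0` curve whose free parameter `t` equals `σ(W, Dt)`, 27469's hypotheses (per-prime
`kolyvaginIndex` form) give the line's (`levelIndex` form) and the conclusions agree — so on its cell the line's K3 and 27469 differ only by the
data with `t ≠ σ(W, Dt)`. [cite: McCallumLMS1991, §5 Thm. 5.4] [cite: WZhang2014, Notations (xii)] -/
theorem kolyvaginExactAtTwoShifted_at_of_structureWithOn (Ω : WeierstrassCurve ℚ → Prop)
    (h : ShiftedKolyvaginStructureModTwoWithOn (fun _ _ => True) Ω)
    (W : WeierstrassCurve ℚ) [W.IsElliptic] [W.IsGloballyMinimal] [NeZero (W.conductorNorm ℤ)]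
    (hCM : ¬ W.HasCM) (hW : Ω W) (K : Type) [Field K] [NumberField K] (hK : IsImaginaryQuadratic K)
    (hodd : Odd (NumberField.discr K)) (h3 : NumberField.discr K ≠ -3) (hH : SatisfiesHeegnerHypothesis (W.conductorNorm ℤ) K)
    (hsq1 : ¬ IsSquare ((NumberField.discr K : ℚ) * -|W.Δ|)) (hsq2 : ¬ IsSquare ((NumberField.discr K : ℚ) * (-(2 * |W.Δ|))))
    (hfull : ∀ m : ℕ, 0 < m → W.HasSurjectiveModNGaloisRep ((2 : ℤ) ^ m))
    (Dt : ModularParametrizationData W (W.conductorNorm ℤ)) (β : ℤ) (ι : K →+* ℂ) (d₁ : KolyvaginHeegnerData Dt β ι 1)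
    (hy : ¬ IsOfFinAddOrder d₁.derivedPoint) (M₀ : ℕ)
    (hdiv : ∃ Q : (W.baseChange (ringClassField K ι 1)).toAffine.Point, ((2 ^ M₀ : ℕ) : ℤ) • Q = d₁.derivedPoint)
    (hndiv : ¬ ∃ Q : (W.baseChange (ringClassField K ι 1)).toAffine.Point, ((2 ^ (M₀ + 1) : ℕ) : ℤ) • Q = d₁.derivedPoint)
    (t : ℕ) (ht : t = sigmaShift W Dt)
    (hK1 : ∀ (s : ℕ), s ≤ t → ∀ (n : ℕ) (d : KolyvaginHeegnerData Dt β ι n), Squarefree n →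
      (∀ ℓ ∈ n.primeFactors, Zhang2014.IsKolyvaginPrime (W.conductorNorm ℤ) W K 2 ℓ ∧ s ≤ Zhang2014.kolyvaginIndex W 2 ℓ) →
      ∃ Q : (W.baseChange (ringClassField K ι n)).toAffine.Point, ((2 ^ s : ℕ) : ℤ) • Q = d.derivedPoint)
    (n : ℕ) (d : KolyvaginHeegnerData Dt β ι n) (hn : Squarefree n)
    (hKoly : ∀ ℓ ∈ n.primeFactors, Zhang2014.IsKolyvaginPrime (W.conductorNorm ℤ) W K 2 ℓ ∧ t + 1 ≤ Zhang2014.kolyvaginIndex W 2 ℓ)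
    (hPn : ¬ ∃ Q : (W.baseChange (ringClassField K ι n)).toAffine.Point, ((2 ^ (t + 1) : ℕ) : ℤ) • Q = d.derivedPoint) :
    Nat.card (AddCommGroup.primaryComponent (W.baseChange K).sha 2) = 2 ^ (2 * (M₀ - t)) := by
  subst ht
  have hρ2 : W.HasSurjectiveModNGaloisRep 2 := by simpa using hfull 1 one_pos
  have hacc : ∀ (n' : ℕ) (d' : KolyvaginHeegnerData Dt β ι n') (m : ℕ), Squarefree n' →
      (∀ ℓ ∈ n'.primeFactors, Zhang2014.IsKolyvaginPrime (W.conductorNorm ℤ) W K 2 ℓ) →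
      (m : ℕ∞) ≤ Zhang2014.levelIndex W 2 n' → m ≤ sigmaShift W Dt →
      ∃ Q : (W.baseChange (ringClassField K ι n')).toAffine.Point, ((2 ^ m : ℕ) : ℤ) • Q = d'.derivedPoint :=
    fun n' d' m hn' hK' hlev' hm =>
      hK1 m hm n' d' hn' fun ℓ hℓ => ⟨hK' ℓ hℓ, Zhang2014.natCast_le_levelIndex_iff.mp hlev' ℓ hℓ⟩
  have hlev : ((sigmaShift W Dt + 1 : ℕ) : ℕ∞) ≤ Zhang2014.levelIndex W 2 n :=
    Zhang2014.natCast_le_levelIndex_iff.mpr fun ℓ hℓ => (hKoly ℓ hℓ).2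
  exact h W hCM hρ2 hW K hK hodd h3 hH hsq1 hsq2 Dt β ι d₁ hy M₀ hdiv hndiv hacc n d hn
    (fun ℓ hℓ => ⟨(hKoly ℓ hℓ).1, trivial⟩) hlev hPn

end Summit.BirchSwinnertonDyer.BirchSwinnertonDyer.Theorems.OffBigImageOddLocalAtTwo

end
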